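import Literature.Probability.LatticeModels.PlaneRotatorOnsagerWindow
import Literature.Probability.LatticeModels.PlaneRotatorStiffnessBoxCriterion
import HarnessLib

/-!
# No stiffness above `T = J/log(1+√2)` in the classical XY comparison model — a theorem without the
# universal-jump input

Topic `Literature/Probability/LatticeModels`, namespace `Literature.Probability.LatticeModels`. The rider of
`PlaneRotatorOnsagerWindow.lean` (Aizenman–Simon 1980 eqs. (1)–(2) [AizenmanSimon1980RotorIsing] × the tree's exact
solution of the planar Ising model ⇒ Lieb's number `S_R(K) < 1` for some `R`, for every `0 ≤ K < log(1+√2) = 2β_c(2)`)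
on the torus engine of the cell (`PlaneRotatorTorusBoxCriterion`: `⟨cos(θ_a − θ_c)⟩_{K,L} ≤ S_R(K)^{⌊dist_∞/R⌋}`;
`PlaneRotatorStiffnessTwoPointBound` / `PlaneRotatorStiffnessBoxCriterion`: `|βΥ_L| ≤ 4K²L²B²`,
`tendsto_torusXYStiffness_of_nnBoxShellSum_lt_one`), for the Fisher–Barber–Jasnow helicity modulus
`torusXYStiffness L K = βΥ_L(K)` of the nearest-neighbour plane rotator on `(ℤ/Lℤ)²` [FisherBarberJasnow1973].

* §1 `torusXY_expectJ_cosDiff_decay_of_lt_log_one_add_sqrt_two` — for `0 ≤ K < log(1+√2)` the TORUS two-point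
  function decays exponentially in the torus distance, uniformly in `L ≥ 2R + 2`.
* §2 **`tendsto_torusXYStiffness_of_lt_log_one_add_sqrt_two`** — `βΥ_L(K) → 0` as `L → ∞` for every
  `0 ≤ K < log(1+√2) ≈ 0.8814` (and along any divergent sequence of sizes, `…_comp_…`).
* §3 `eq_zero_of_tendsto_torusXYStiffness_of_div_log_lt` — in temperature units (`K = J/T`): any limit
  `ρ(T) = lim_n T·βΥ_{L_n}(J/T)` along `L_n → ∞` VANISHES for `T > J/log(1+√2)`.
* §4 **`kt_le_div_log_one_add_sqrt_two_of_pos_below`** — hence every stiffness profile obtained this way that is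
  POSITIVE on `(0, T_c)` has `T_c ≤ J/log(1+√2)`; instances `…_of_isTransitionAt` (the T1 file's
  `IsTransitionAt ρ T_c`) and `…_of_stableBelow` (`StableBelow ρ T_c`, whose positivity half alone is used), and the
  decimal `T_c ≤ 1.1346·J` (`kt_le_decimal_of_pos_below`).
* §5 `torusXY_not_uniform_decay_stiffnessExponent_of_lt_log_one_add_sqrt_two` — the cell's typing corollary (no
  uniform power law with `βΥ_L(K)` in the exponent) for every `0 < K < log(1+√2)`.

Reading (cell `pub/hubbard-tc`, MO-S3, crux №2 classical side): the classical bound of record under K2 alone is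
`T_KT^{XY} ≤ (7/6)·J = 1.1667·J` (`kt_le_seven_sixths_of_stableBelow_of_tendsto_torusXYStiffness`, wired energy ceiling +
the stability inequality `StableBelow`); here `T_c ≤ J/log(1+√2) = 1.1346·J` holds for EVERY profile positive below
`T_c`, with NO Kosterlitz–Thouless input — the price is the thermodynamic limit `L_n → ∞` in the hypothesis (at fixed
`L` the modulus is positive at every `K > 0`, `torusXYStiffness_pos`, so no finite-size statement of this kind exists),
where the K2 readings, being pure ceilings, hold along any sizes `L_n ≥ 3`.

## What this is not

Classical comparison model only; the window `K < log(1+√2) = 0.8814` is Aizenman–Simon's, below the Kosterlitz–Thouless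
point `K_c ≈ 1.12` [float]; the universal-jump relation is neither used nor proved; nothing electronic, no kelvin.
-/

noncomputable section

open MeasureTheory Finset Filter Topology
open scoped BigOperators

namespace Literature.Probability.LatticeModels

open PlaneRotator Literature.MathematicalPhysics.QuantumLattice
open Literature.MathematicalPhysics.StatisticalMechanics.KosterlitzThouless

variable [MeasurableSpace Circle] [BorelSpace Circle]

/-! ## §1 Exponential decay of the torus two-point function throughout the Onsager window -/

/-- **Torus clustering for `K < log(1+√2)`.** For every `0 ≤ K < log(1+√2)` there are a box radius `R ≥ 1` and
`0 ≤ s < 1` (namely `s = S_R(K)`) such that on every torus `(ℤ/Lℤ)²` with `L ≥ 2R + 2` and for all sites `a, c`: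
`⟨cos(θ_a − θ_c)⟩_{K,L} ≤ s^{⌊dist_∞(a,c)/R⌋}` — Lieb's criterion on the torus fed with the Onsager-window box number.
[cite: AizenmanSimon1980RotorIsing, eqs. (1)–(2); Lieb1980, Theorem 4 and p. 128 (boxes)] -/
theorem torusXY_expectJ_cosDiff_decay_of_lt_log_one_add_sqrt_two {K : ℝ} (hK0 : 0 ≤ K)
    (hK : K < Real.log (1 + Real.sqrt 2)) :
    ∃ R : ℕ, 1 ≤ R ∧ ∃ s : ℝ, 0 ≤ s ∧ s < 1 ∧ ∀ (L : ℕ) [NeZero L], 2 * R + 2 ≤ L →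
      ∀ a c : TorusSite 2 L, (torusXY 2 L).expectJ (fun _ => K) (cosDiff a c) ≤ s ^ (torusDist a c / R) := by
  obtain ⟨R, hR, hS⟩ := exists_nnBoxShellSum_lt_one_of_lt_log_one_add_sqrt_two hK0 hK
  exact ⟨R, hR, nnBoxShellSum K 2 R, nnBoxShellSum_nonneg hK0 2 R, hS,
    fun L _ hL a c => torusXY_expectJ_cosDiff_le_pow_nnBoxShellSum hR hL hK0 a c⟩

/-! ## §2 The helicity modulus vanishes in the thermodynamic limit for every `K < log(1+√2)` -/

/-- **No stiffness in the Onsager window.** For every `0 ≤ K < log(1+√2) = 2β_c^{Ising}(2) ≈ 0.8814` the helicity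
modulus of the plane rotator on `(ℤ/Lℤ)²` tends to zero: `βΥ_L(K) → 0` as `L → ∞` — Aizenman–Simon × Onsager for the
box number (`exists_nnBoxShellSum_lt_one_of_lt_log_one_add_sqrt_two`), then the box-criterion engine for the modulus
(`tendsto_torusXYStiffness_of_nnBoxShellSum_lt_one`). No hypothesis.
[cite: AizenmanSimon1980RotorIsing, eq. (2); FisherBarberJasnow1973, §II (helicity modulus)] -/
theorem tendsto_torusXYStiffness_of_lt_log_one_add_sqrt_two {K : ℝ} (hK0 : 0 ≤ K)
    (hK : K < Real.log (1 + Real.sqrt 2)) :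
    Tendsto (fun L : ℕ => torusXYStiffness (L + 1) K) atTop (𝓝 0) := by
  obtain ⟨R, hR, hS⟩ := exists_nnBoxShellSum_lt_one_of_lt_log_one_add_sqrt_two hK0 hK
  exact tendsto_torusXYStiffness_of_nnBoxShellSum_lt_one hR hK0 hS

/-- Re-indexing of the helicity modulus along equal sizes (the size instance is a proposition). [folklore] -/
private theorem torusXYStiffness_congr_size {L L' : ℕ} [NeZero L] [NeZero L'] (h : L = L') (K : ℝ) :
    torusXYStiffness L K = torusXYStiffness L' K := by
  subst h; rfl

/-- **The same along any divergent sequence of sizes** `L_n → ∞`: `βΥ_{L_n}(K) → 0` for `0 ≤ K < log(1+√2)`.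
[cite: AizenmanSimon1980RotorIsing, eq. (2); FisherBarberJasnow1973, §II (helicity modulus)] -/
theorem tendsto_torusXYStiffness_comp_of_lt_log_one_add_sqrt_two {K : ℝ} (hK0 : 0 ≤ K)
    (hK : K < Real.log (1 + Real.sqrt 2)) (Ls : ℕ → ℕ) [∀ n, NeZero (Ls n)]
    (hLs : Tendsto Ls atTop atTop) :
    Tendsto (fun n => torusXYStiffness (Ls n) K) atTop (𝓝 0) := by
  have h := (tendsto_torusXYStiffness_of_lt_log_one_add_sqrt_two hK0 hK).comp
    ((tendsto_sub_atTop_nat 1).comp hLs)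
  refine h.congr fun n => ?_
  simp only [Function.comp_def]
  exact torusXYStiffness_congr_size (Nat.sub_add_cancel (Nat.one_le_iff_ne_zero.2 (NeZero.ne (Ls n)))) K

/-- **Eventual smallness**: for `0 ≤ K < log(1+√2)` and `ε > 0`, eventually `0 ≤ βΥ_{L+1}(K) < ε`.
[cite: AizenmanSimon1980RotorIsing, eq. (2); FisherBarberJasnow1973, §II (helicity modulus)] -/
theorem eventually_torusXYStiffness_lt_of_lt_log_one_add_sqrt_two {K : ℝ} (hK0 : 0 ≤ K)
    (hK : K < Real.log (1 + Real.sqrt 2)) {ε : ℝ} (hε : 0 < ε) :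
    ∀ᶠ L : ℕ in atTop, 0 ≤ torusXYStiffness (L + 1) K ∧ torusXYStiffness (L + 1) K < ε := by
  filter_upwards [(tendsto_torusXYStiffness_of_lt_log_one_add_sqrt_two hK0 hK).eventually
    (gt_mem_nhds hε)] with L hL
  exact ⟨torusXYStiffness_nonneg hK0, hL⟩

/-! ## §3 Temperature units: the thermodynamic stiffness vanishes above `T = J/log(1+√2)` -/

omit [MeasurableSpace Circle] [BorelSpace Circle] in
/-- `J/log(1+√2) < T` with `J > 0` puts `K = J/T` in the window `0 ≤ K < log(1+√2)` (and `T > 0`). [folklore] -/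
private theorem coupling_mem_window {J T : ℝ} (hJ : 0 < J) (hT : J / Real.log (1 + Real.sqrt 2) < T) :
    0 < T ∧ 0 ≤ J / T ∧ J / T < Real.log (1 + Real.sqrt 2) := by
  have hlog : 0 < Real.log (1 + Real.sqrt 2) := by
    rw [log_one_add_sqrt_two_eq_two_mul_criticalBetaTwo]; exact mul_pos two_pos criticalBetaTwo_pos
  have hT0 : 0 < T := (div_pos hJ hlog).trans hT
  refine ⟨hT0, by positivity, ?_⟩
  rw [div_lt_iff₀ hT0]
  rw [div_lt_iff₀ hlog] at hT
  linarith

/-- **The thermodynamic stiffness vanishes for `T > J/log(1+√2)`.** Let `J > 0` and `T > J/log(1+√2)`; if along some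
divergent sequence of sizes `L_n → ∞` the finite-volume stiffness `T·βΥ_{L_n}(J/T) = Υ_{L_n}(T)` converges to `ρ`,
then `ρ = 0`. (Classical comparison model; `K = J/T < log(1+√2)` is the Aizenman–Simon–Onsager window.)
[cite: AizenmanSimon1980RotorIsing, eq. (2); FisherBarberJasnow1973, eq. (2.5) (thermodynamic helicity modulus)] -/
theorem eq_zero_of_tendsto_torusXYStiffness_of_div_log_lt {J T ρ : ℝ} (hJ : 0 < J)
    (hT : J / Real.log (1 + Real.sqrt 2) < T) (Ls : ℕ → ℕ) [∀ n, NeZero (Ls n)]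
    (hLs : Tendsto Ls atTop atTop)
    (hlim : Tendsto (fun n => T * torusXYStiffness (Ls n) (J / T)) atTop (𝓝 ρ)) : ρ = 0 := by
  obtain ⟨-, hK0, hK⟩ := coupling_mem_window hJ hT
  have h0 := (tendsto_torusXYStiffness_comp_of_lt_log_one_add_sqrt_two hK0 hK Ls hLs).const_mul T
  rw [mul_zero] at h0
  exact tendsto_nhds_unique hlim h0

/-! ## §4 `T_c ≤ J/log(1+√2) = 1.1346·J` for every profile positive below `T_c` — no universal-jump input -/

/-- **`T_c ≤ J/log(1+√2)` without the universal-jump input.** Let `J > 0` and let the stiffness profile `ρ` of the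
classical XY comparison model be the thermodynamic limit `ρ(T) = lim_n T·βΥ_{L_n}(J/T)` along sizes `L_n → ∞` for
`0 < T < T_c`. If `ρ > 0` on `(0, T_c)` (ANY notion of "ordered below `T_c`": `IsTransitionAt`, `StableBelow`, …),
then `T_c ≤ J/log(1+√2)`: otherwise some `T ∈ (J/log(1+√2), T_c)` has `ρ(T) = 0` by §3. Compare the K2-conditional
bound of record `T_c ≤ (7/6)·J` (`kt_le_seven_sixths_of_stableBelow_of_tendsto_torusXYStiffness`).
[cite: AizenmanSimon1980RotorIsing, eq. (2) (k T_c^R/J ≤ 1/ln(1+√2) = 1.13)] -/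
theorem kt_le_div_log_one_add_sqrt_two_of_pos_below {ρ : ℝ → ℝ} {Tc J : ℝ} (hJ : 0 < J)
    (hpos : ∀ ⦃T : ℝ⦄, 0 < T → T < Tc → 0 < ρ T)
    (Ls : ℕ → ℕ) [∀ n, NeZero (Ls n)] (hLs : Tendsto Ls atTop atTop)
    (hlim : ∀ ⦃T : ℝ⦄, 0 < T → T < Tc →
      Tendsto (fun n => T * torusXYStiffness (Ls n) (J / T)) atTop (𝓝 (ρ T))) :
    Tc ≤ J / Real.log (1 + Real.sqrt 2) := by
  by_contra h
  have hlt : J / Real.log (1 + Real.sqrt 2) < Tc := lt_of_not_ge h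
  -- a temperature strictly inside `(J/log(1+√2), T_c)`
  set T : ℝ := (J / Real.log (1 + Real.sqrt 2) + Tc) / 2 with hTdef
  have hT1 : J / Real.log (1 + Real.sqrt 2) < T := by rw [hTdef]; linarith
  have hT2 : T < Tc := by rw [hTdef]; linarith
  obtain ⟨hT0, -, -⟩ := coupling_mem_window hJ hT1
  have hzero := eq_zero_of_tendsto_torusXYStiffness_of_div_log_lt hJ hT1 Ls hLs (hlim hT0 hT2)
  exact (hpos hT0 hT2).ne' hzero

/-- **Instance: a stiffness transition in the sense of the T1 file** (`IsTransitionAt ρ T_c`: `ρ > 0` on `(0, T_c)`,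
`ρ = 0` above) of the classical XY comparison model has `T_c ≤ J/log(1+√2)` — with no universal-jump input.
[cite: AizenmanSimon1980RotorIsing, eq. (2)] -/
theorem kt_le_div_log_one_add_sqrt_two_of_isTransitionAt {ρ : ℝ → ℝ} {Tc J : ℝ} (hJ : 0 < J)
    (htr : IsTransitionAt ρ Tc) (Ls : ℕ → ℕ) [∀ n, NeZero (Ls n)] (hLs : Tendsto Ls atTop atTop)
    (hlim : ∀ ⦃T : ℝ⦄, 0 < T → T < Tc →
      Tendsto (fun n => T * torusXYStiffness (Ls n) (J / T)) atTop (𝓝 (ρ T))) :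
    Tc ≤ J / Real.log (1 + Real.sqrt 2) :=
  kt_le_div_log_one_add_sqrt_two_of_pos_below hJ htr.1 Ls hLs hlim

/-- **Instance: under the stability inequality** (`StableBelow ρ T_c`, of which only the positivity
`ρ(T) ≥ (2/π)T > 0` below `T_c` is used) the same `T_c ≤ J/log(1+√2) = 1.1346·J` — to be compared with the
`(7/6)·J = 1.1667·J` that the stability inequality yields through the wired energy ceiling
(`kt_le_seven_sixths_of_stableBelow_of_tendsto_torusXYStiffness`): inside the Onsager window the K2 input is idle.
[cite: AizenmanSimon1980RotorIsing, eq. (2); Nelson2002Defects, §2.2.2 eq. (2.47) (stability inequality, as hypothesis)] -/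
theorem kt_le_div_log_one_add_sqrt_two_of_stableBelow {ρ : ℝ → ℝ} {Tc J : ℝ} (hJ : 0 < J)
    (hst : StableBelow ρ Tc) (Ls : ℕ → ℕ) [∀ n, NeZero (Ls n)] (hLs : Tendsto Ls atTop atTop)
    (hlim : ∀ ⦃T : ℝ⦄, 0 < T → T < Tc →
      Tendsto (fun n => T * torusXYStiffness (Ls n) (J / T)) atTop (𝓝 (ρ T))) :
    Tc ≤ J / Real.log (1 + Real.sqrt 2) :=
  kt_le_div_log_one_add_sqrt_two_of_pos_below hJ (fun _ hT hTTc => hst.pos hT hTTc) Ls hLs hlim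

/-- **The decimal form `T_c ≤ 1.1346·J`** (`1/log(1+√2) = 1.134593… < 1.1346`, `inv_log_one_add_sqrt_two_lt`).
[cite: AizenmanSimon1980RotorIsing, eq. (2) (k T_c^R/J ≤ 1.13)] -/
theorem kt_le_decimal_of_pos_below {ρ : ℝ → ℝ} {Tc J : ℝ} (hJ : 0 < J)
    (hpos : ∀ ⦃T : ℝ⦄, 0 < T → T < Tc → 0 < ρ T)
    (Ls : ℕ → ℕ) [∀ n, NeZero (Ls n)] (hLs : Tendsto Ls atTop atTop)
    (hlim : ∀ ⦃T : ℝ⦄, 0 < T → T < Tc →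
      Tendsto (fun n => T * torusXYStiffness (Ls n) (J / T)) atTop (𝓝 (ρ T))) :
    Tc ≤ 11346 / 10000 * J := by
  refine (kt_le_div_log_one_add_sqrt_two_of_pos_below hJ hpos Ls hLs hlim).trans ?_
  have h := inv_log_one_add_sqrt_two_lt
  have hlog : 0 < Real.log (1 + Real.sqrt 2) := by
    rw [log_one_add_sqrt_two_eq_two_mul_criticalBetaTwo]; exact mul_pos two_pos criticalBetaTwo_pos
  rw [div_eq_mul_one_div]
  exact mul_le_mul_of_nonneg_left h.le hJ.le |>.trans_eq (by ring)

/-! ## §5 The «`Υ_L` in the exponent» typing rule is refuted throughout the window -/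

/-- **The bare `Υ_L`-form of the stiffness-class decay statement is false for every `0 < K < log(1+√2)`**: there are
no constants `A`, `B > 0` with `|⟨cos(θ_x − θ_y)⟩_{K,L}| ≤ A·B^{1/(2πβΥ_L)}·(dist_∞(x,y)+1)^{−1/(2πβΥ_L)}` on all tori
`L ≥ 3` — the window version of the cell's typing corollary
(`torusXY_not_uniform_decay_stiffnessExponent_of_nnBoxShellSum_lt_one`, which needs ONE box number `< 1`; here the
box number is supplied by `exists_nnBoxShellSum_lt_one_of_lt_log_one_add_sqrt_two`).
[cite: AizenmanSimon1980RotorIsing, eq. (2); FisherBarberJasnow1973, §II (helicity modulus)] -/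
theorem torusXY_not_uniform_decay_stiffnessExponent_of_lt_log_one_add_sqrt_two {K : ℝ} (hK0 : 0 < K)
    (hK : K < Real.log (1 + Real.sqrt 2)) (A : ℝ) {B : ℝ} (hB : 0 < B) :
    ¬ ∀ (L : ℕ) [NeZero L], 3 ≤ L → ∀ x y : TorusSite 2 L,
        |(torusXY 2 L).expect K 1 (cosDiff x y)| ≤
          A * (B ^ (1 / (2 * Real.pi * torusXYStiffness L K)) *
            ((torusDist x y : ℝ) + 1) ^ (-(1 / (2 * Real.pi * torusXYStiffness L K)))) := by
  obtain ⟨R, hR, hS⟩ := exists_nnBoxShellSum_lt_one_of_lt_log_one_add_sqrt_two hK0.le hK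
  exact torusXY_not_uniform_decay_stiffnessExponent_of_nnBoxShellSum_lt_one hR hK0 hS A hB

end Literature.Probability.LatticeModels

end
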